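import Literature.InformationTheory.Coding.SourcePolarizationStepProofs
import Literature.InformationTheory.Coding.SourcePolarizationStepAnalysis
import HarnessLib

/-!
# One step of source polarization, III: `H ≤ 1` and Arıkan's `Z² ≤ H ≤ log₂(1 + Z)`

Theorem-only companion of `Literature/InformationTheory/Coding/SourcePolarizationStep.lean`.
For a binary source with functional side information `g : ZMod 2 → Ω → β` over a nonempty finite
`Ω` (conditional entropy `H = condEntG g`, Bhattacharyya parameter `Z = bhatta g`):

* `condEntG_le_one` — `H(B | Y) ≤ 1` [Cover–Thomas, Thm 2.6.4 with conditioning];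
* `sq_bhatta_le_condEntG` — `Z² ≤ H` [Arıkan 2010, Prop. 2]: termwise `4N₀N₁/(N₀+N₁) ≤ pairEnt N₀ N₁`
  (`h₂(p) ≥ 4p(1−p)`), then Cauchy–Schwarz `(Σ_y √(N₀N₁))² ≤ (Σ_y (N₀+N₁)/2)(Σ_y 2N₀N₁/(N₀+N₁))`;
* `condEntG_le_logb` — `H ≤ log₂(1 + Z)` [Arıkan 2010, Prop. 2]: termwise
  `pairEnt N₀ N₁ ≤ (N₀+N₁) log₂(1 + 2√(N₀N₁)/(N₀+N₁))`, then Jensen for the concave `log` with the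
  output law `P(y) = (N₀+N₁)/(2|Ω|)` as weights;
and the packaged forms `Src.H_le_one`, `Src.sq_zParam_le_H`, `Src.H_le_logb`.

## References

* E. Arıkan, *Source polarization*, Proc. IEEE ISIT 2010, Prop. 2.  bib `Arikan2010`.
* T. M. Cover, J. A. Thomas, *Elements of Information Theory*, 2nd ed., 2006, Thm 2.6.4–2.6.5.
-/

noncomputable section

namespace Literature.InformationTheory.Coding.Polar

open Finset Literature.InformationTheory.Entropy

variable {Ω : Type*} [Fintype Ω] {β : Type*} [DecidableEq β]

/-- Every output that occurs has a positive total count `N₀(y) + N₁(y) > 0`. [folklore] -/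
theorem cnt_add_cnt_pos (g : ZMod 2 → Ω → β) {y : β}
    (hy : y ∈ univ.image (fun p : ZMod 2 × Ω => g p.1 p.2)) :
    (0 : ℝ) < cnt g 0 y + cnt g 1 y := by
  obtain ⟨b, w, rfl⟩ := (mem_image_out_iff g y).1 hy
  have h1 : (0 : ℝ) < cnt g b (g b w) := by exact_mod_cast cnt_pos g b w
  have h2 : (cnt g b (g b w) : ℝ) ≤ ∑ b', (cnt g b' (g b w) : ℝ) :=
    Finset.single_le_sum (f := fun b' => (cnt g b' (g b w) : ℝ)) (fun _ _ => Nat.cast_nonneg _)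
      (mem_univ b)
  rw [sum_zmod_two] at h2
  linarith

/-- The total counts over the image add up to `2|Ω|`. [folklore] -/
theorem sum_cnt_add_cnt (g : ZMod 2 → Ω → β) :
    ∑ y ∈ univ.image (fun p : ZMod 2 × Ω => g p.1 p.2), ((cnt g 0 y : ℝ) + cnt g 1 y) =
      2 * Fintype.card Ω := by
  rw [Finset.sum_add_distrib, sum_cnt_real g 0 _ fun w => mem_image_out g 0 w,
    sum_cnt_real g 1 _ fun w => mem_image_out g 1 w]
  ring

/-- **`H(B | Y) ≤ 1`** for a binary source (termwise `pairEnt N₀ N₁ ≤ N₀ + N₁`, i.e. `h₂ ≤ 1`).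
[cite: CoverThomas2006, Thm 2.6.4 (H(X) ≤ log |𝒳|, here conditionally on Y)] -/
theorem condEntG_le_one [Nonempty Ω] (g : ZMod 2 → Ω → β) : condEntG g ≤ 1 := by
  have hM : (0 : ℝ) < Fintype.card Ω := by exact_mod_cast Fintype.card_pos
  rw [condEntG_eq_sum_pairEnt g _ fun b w => mem_image_out g b w, div_le_one (by positivity),
    ← sum_cnt_add_cnt g]
  exact Finset.sum_le_sum fun y _ => pairEnt_le_add (Nat.cast_nonneg _) (Nat.cast_nonneg _)

/-- **Arıkan's `Z(X|Y)² ≤ H(X|Y)`** for a binary source with functional side information: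
termwise `4N₀N₁/(N₀+N₁) ≤ pairEnt N₀ N₁` (`h₂(p) ≥ 4p(1−p)`) and Cauchy–Schwarz in the form
`(Σ_y √(N₀N₁))² ≤ (Σ_y (N₀+N₁)/2) · (Σ_y 2N₀N₁/(N₀+N₁)) = |Ω| · Σ_y 2N₀N₁/(N₀+N₁)`.
[cite: Arikan2010, Prop. 2 (Z(X|Y)² ≤ H(X|Y))] -/
theorem sq_bhatta_le_condEntG [Nonempty Ω] (g : ZMod 2 → Ω → β) : bhatta g ^ 2 ≤ condEntG g := by
  have hM : (0 : ℝ) < Fintype.card Ω := by exact_mod_cast Fintype.card_pos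
  set T := univ.image (fun p : ZMod 2 × Ω => g p.1 p.2) with hT
  have hpos : ∀ y ∈ T, (0 : ℝ) < cnt g 0 y + cnt g 1 y := fun y hy => cnt_add_cnt_pos g hy
  -- Cauchy–Schwarz
  have hCS : (∑ y ∈ T, Real.sqrt (cnt g 0 y * cnt g 1 y)) ^ 2 ≤
      (∑ y ∈ T, ((cnt g 0 y : ℝ) + cnt g 1 y) / 2) *
        ∑ y ∈ T, 2 * (cnt g 0 y : ℝ) * cnt g 1 y / (cnt g 0 y + cnt g 1 y) := by
    refine sum_sq_le_sum_mul_sum_of_sq_le_mul T (fun y _ => by positivity)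
      (fun y _ => by positivity) fun y hy => le_of_eq ?_
    rw [Real.sq_sqrt (by positivity)]
    have := (hpos y hy).ne'
    field_simp
  have hhalf : ∑ y ∈ T, ((cnt g 0 y : ℝ) + cnt g 1 y) / 2 = Fintype.card Ω := by
    rw [← Finset.sum_div, sum_cnt_add_cnt g]
    ring
  rw [hhalf] at hCS
  -- termwise `h₂ ≥ 4p(1-p)`
  have hterm : ∑ y ∈ T, 2 * (cnt g 0 y : ℝ) * cnt g 1 y / (cnt g 0 y + cnt g 1 y) ≤
      (∑ y ∈ T, pairEnt (cnt g 0 y) (cnt g 1 y)) / 2 := by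
    rw [le_div_iff₀ two_pos, Finset.sum_mul]
    refine Finset.sum_le_sum fun y _ => ?_
    have h := four_mul_div_le_pairEnt (a := (cnt g 0 y : ℝ)) (b := cnt g 1 y) (Nat.cast_nonneg _)
      (Nat.cast_nonneg _)
    calc 2 * (cnt g 0 y : ℝ) * cnt g 1 y / (cnt g 0 y + cnt g 1 y) * 2
        = 4 * (cnt g 0 y : ℝ) * cnt g 1 y / (cnt g 0 y + cnt g 1 y) := by ring
      _ ≤ pairEnt (cnt g 0 y) (cnt g 1 y) := h
  calc bhatta g ^ 2 = (∑ y ∈ T, Real.sqrt (cnt g 0 y * cnt g 1 y)) ^ 2 / (Fintype.card Ω) ^ 2 := by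
        rw [bhatta, div_pow]
    _ ≤ (Fintype.card Ω * ∑ y ∈ T, 2 * (cnt g 0 y : ℝ) * cnt g 1 y / (cnt g 0 y + cnt g 1 y)) /
          (Fintype.card Ω) ^ 2 := by gcongr
    _ = (∑ y ∈ T, 2 * (cnt g 0 y : ℝ) * cnt g 1 y / (cnt g 0 y + cnt g 1 y)) / Fintype.card Ω := by
        field_simp
    _ ≤ (∑ y ∈ T, pairEnt (cnt g 0 y) (cnt g 1 y)) / 2 / Fintype.card Ω := by gcongr
    _ = (∑ y ∈ T, pairEnt (cnt g 0 y) (cnt g 1 y)) / (2 * Fintype.card Ω) := by rw [div_div]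
    _ = condEntG g := (condEntG_eq_sum_pairEnt g T fun b w => mem_image_out g b w).symm

/-- **Arıkan's `H(X|Y) ≤ log₂(1 + Z(X|Y))`** for a binary source with functional side
information: termwise `pairEnt N₀ N₁ ≤ (N₀+N₁) log₂(1 + 2√(N₀N₁)/(N₀+N₁))` (Shannon ≤ Rényi-1/2),
then Jensen's inequality for the concave `log` with weights `P(y) = (N₀+N₁)/(2|Ω|)`:
`Σ_y P(y) log(1 + z_y) ≤ log(1 + Σ_y P(y) z_y) = log(1 + Z)`.
[cite: Arikan2010, Prop. 2 (H(X|Y) ≤ log(1 + Z(X|Y)))] -/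
theorem condEntG_le_logb [Nonempty Ω] (g : ZMod 2 → Ω → β) :
    condEntG g ≤ Real.logb 2 (1 + bhatta g) := by
  have hM : (0 : ℝ) < Fintype.card Ω := by exact_mod_cast Fintype.card_pos
  have hc0 : 0 < Real.log 2 := Real.log_pos one_lt_two
  set T := univ.image (fun p : ZMod 2 × Ω => g p.1 p.2) with hT
  have hpos : ∀ y ∈ T, (0 : ℝ) < cnt g 0 y + cnt g 1 y := fun y hy => cnt_add_cnt_pos g hy
  -- termwise bound
  have h1 : ∑ y ∈ T, pairEnt (cnt g 0 y) (cnt g 1 y) ≤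
      ∑ y ∈ T, ((cnt g 0 y : ℝ) + cnt g 1 y) *
        Real.logb 2 (1 + 2 * Real.sqrt (cnt g 0 y * cnt g 1 y) / (cnt g 0 y + cnt g 1 y)) :=
    Finset.sum_le_sum fun y hy => pairEnt_le_mul_logb (Nat.cast_nonneg _) (Nat.cast_nonneg _)
      (hpos y hy)
  -- Jensen
  have hJ := (strictConcaveOn_log_Ioi).concaveOn.le_map_sum (t := T)
    (w := fun y => ((cnt g 0 y : ℝ) + cnt g 1 y) / (2 * Fintype.card Ω))
    (p := fun y => 1 + 2 * Real.sqrt (cnt g 0 y * cnt g 1 y) / (cnt g 0 y + cnt g 1 y))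
    (fun y _ => by positivity)
    (by rw [← Finset.sum_div, sum_cnt_add_cnt g, div_self (by positivity)])
    (fun y _ => Set.mem_Ioi.2 (by positivity))
  simp only [smul_eq_mul] at hJ
  -- the Jensen point is `1 + Z`
  have hpt : ∑ y ∈ T, ((cnt g 0 y : ℝ) + cnt g 1 y) / (2 * Fintype.card Ω) *
      (1 + 2 * Real.sqrt (cnt g 0 y * cnt g 1 y) / (cnt g 0 y + cnt g 1 y)) = 1 + bhatta g := by
    have hterm : ∀ y ∈ T, ((cnt g 0 y : ℝ) + cnt g 1 y) / (2 * Fintype.card Ω) *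
        (1 + 2 * Real.sqrt (cnt g 0 y * cnt g 1 y) / (cnt g 0 y + cnt g 1 y)) =
        (((cnt g 0 y : ℝ) + cnt g 1 y) + 2 * Real.sqrt (cnt g 0 y * cnt g 1 y)) /
          (2 * Fintype.card Ω) := by
      intro y hy
      have := (hpos y hy).ne'
      field_simp
    rw [Finset.sum_congr rfl hterm, ← Finset.sum_div, Finset.sum_add_distrib, sum_cnt_add_cnt g,
      ← Finset.mul_sum, bhatta, ← hT]
    field_simp
  rw [hpt] at hJ
  -- assemble
  calc condEntG g = (∑ y ∈ T, pairEnt (cnt g 0 y) (cnt g 1 y)) / (2 * Fintype.card Ω) :=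
        condEntG_eq_sum_pairEnt g T fun b w => mem_image_out g b w
    _ ≤ (∑ y ∈ T, ((cnt g 0 y : ℝ) + cnt g 1 y) *
          Real.logb 2 (1 + 2 * Real.sqrt (cnt g 0 y * cnt g 1 y) / (cnt g 0 y + cnt g 1 y))) /
          (2 * Fintype.card Ω) := by gcongr
    _ = (∑ y ∈ T, ((cnt g 0 y : ℝ) + cnt g 1 y) / (2 * Fintype.card Ω) *
          Real.log (1 + 2 * Real.sqrt (cnt g 0 y * cnt g 1 y) / (cnt g 0 y + cnt g 1 y))) /
          Real.log 2 := by
        rw [eq_div_iff hc0.ne', div_mul_eq_mul_div,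
          div_eq_iff (by positivity : (2 * (Fintype.card Ω : ℝ)) ≠ 0), Finset.sum_mul,
          Finset.sum_mul]
        refine Finset.sum_congr rfl fun y _ => ?_
        simp only [Real.logb]
        field_simp
    _ ≤ Real.log (1 + bhatta g) / Real.log 2 := by gcongr
    _ = Real.logb 2 (1 + bhatta g) := rfl

/-! ### Packaged forms -/

/-- `H ≤ 1` for a packaged source. [cite: CoverThomas2006, Thm 2.6.4 (H(X) ≤ log |𝒳|, here conditionally on Y)] -/
theorem Src.H_le_one (S : Src) : S.H ≤ 1 :=
  condEntG_le_one S.g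

/-- `Z² ≤ H` for a packaged source. [cite: Arikan2010, Prop. 2 (Z(X|Y)² ≤ H(X|Y))] -/
theorem Src.sq_zParam_le_H (S : Src) : S.zParam ^ 2 ≤ S.H :=
  sq_bhatta_le_condEntG S.g

/-- `H ≤ log₂(1 + Z)` for a packaged source. [cite: Arikan2010, Prop. 2 (H(X|Y) ≤ log(1 + Z(X|Y)))] -/
theorem Src.H_le_logb (S : Src) : S.H ≤ Real.logb 2 (1 + S.zParam) :=
  condEntG_le_logb S.g

end Literature.InformationTheory.Coding.Polar

end
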